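import Summits.QuantumAdvantage.QuantumAdvantage.Theorems.CharDialTransferDialG
import HarnessLib

/-!
# TransferDial H — kernel of `RainbowBound`, II: thin homogeneous restriction systems have symmetric level 2 (K2)

Abstract restriction systems in an ℕ-indexed word encoding: a level-`ℓ` function reads only positions `< ℓ` of a word `x : ℕ → Bool`
(`Reads`); the restriction `resN s c ψ` inserts the letter `c` at position `s`.  `level_two_symmetric_of_thin`: if the levels `Ψ ℓ`
(`2 ≤ ℓ ≤ t`) have surjective first- and last-letter restrictions `Ψ (ℓ+1) → Ψ ℓ`, the top level is closed under all restrictions into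
level `t − 1`, `|Ψ t|, |Ψ (t−1)| ≤ R`, `(R·R)^R < A` and `5A + 1 ≤ t`, then every `g ∈ Ψ 2` is symmetric.  Steps: `exists_jump` (pigeonhole on
the `A` window positions coloured by restriction pairs: two positions `s < s'` restrict identically for EVERY top-level function — the jump
relation `JN (Ψ t) s (s'−s)`), `JN_down_first` / `JN_down_last` / `JN_all` (front/back deletions move it to every location on level
`s + L`), `sym_of_JN` (part G ⟹ transposition symmetry there), `symBelow_resN_zero` / `level_two_symmetric` (descent to level 2).

Tree twin, part H of the decomp-qadv lens-6 g23 addendum (`g23/RainbowKernel.lean` §HomSys, bodies verbatim, namespace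
`…Theses.SliceDial.HomSys` ↦ `…Theorems.TransferDial.HomSys`).  0 sorry; no `instance`, no `notation`, no `native_decide`.
-/

set_option autoImplicit false
set_option linter.dupNamespace false

namespace Summit.QuantumAdvantage.QuantumAdvantage.Theorems.TransferDial.HomSys

open Summit.QuantumAdvantage.QuantumAdvantage.Theorems.TransferDial.JumpSym

variable {V : Type*}

/-- insert the letter `c` at position `s` (positions `≥ s` shift up). -/
def insN (s : ℕ) (c : Bool) (y : ℕ → Bool) : ℕ → Bool :=
  fun i => if i < s then y i else if i = s then c else y (i - 1)

/-- delete the letter at position `q` (positions `> q` shift down). -/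
def delN (q : ℕ) (x : ℕ → Bool) : ℕ → Bool :=
  fun i => if i < q then x i else x (i + 1)

/-- restriction of a word function at position `s` with letter `c`. -/
def resN (s : ℕ) (c : Bool) (ψ : (ℕ → Bool) → V) : (ℕ → Bool) → V := fun y => ψ (insN s c y)

/-- the jump in the ℕ-encoding: remove the letter at `q` and re-insert it at `q+L`. -/
def jrN (q L : ℕ) (x : ℕ → Bool) : ℕ → Bool := insN (q + L) (x q) (delN q x)

/-- transposition of two positions of an ℕ-indexed word. -/
def swN (a b : ℕ) (x : ℕ → Bool) : ℕ → Bool := fun i => x (Equiv.swap a b i)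

/-- Re-inserting the deleted letter restores the word. -/
theorem insN_delN (q : ℕ) (x : ℕ → Bool) : insN q (x q) (delN q x) = x := by
  funext i; unfold insN delN
  split_ifs <;> first | rfl | (congr 1; omega)

/-- Two insertions commute (with the index shift). -/
theorem insN_comm (q m : ℕ) (hqm : q ≤ m) (c c' : Bool) (y : ℕ → Bool) :
    insN (m + 1) c' (insN q c y) = insN q c (insN m c' y) := by
  funext i; unfold insN
  split_ifs <;> first | rfl | (congr 1; omega)

/-- The jump relation at level `ℓ` for a predicate `P` (= membership in `Ψ ℓ`): location `q`, length `L`. -/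
def JN (P : ((ℕ → Bool) → V) → Prop) (q L : ℕ) : Prop :=
  ∀ ψ, P ψ → ∀ (y : ℕ → Bool) (c : Bool), ψ (insN q c y) = ψ (insN (q + L) c y)

/-- (F5a) deleting the LAST letter keeps the location. -/
theorem JN_down_last (P P' : ((ℕ → Bool) → V) → Prop) (ℓ q L : ℕ) (hq : q + L < ℓ)
    (hsurj : ∀ ψ', P' ψ' → ∃ ψ c, P ψ ∧ resN ℓ c ψ = ψ') (hJ : JN P q L) : JN P' q L := by
  intro ψ' hψ' y c
  obtain ⟨ψ, c', hψ, rfl⟩ := hsurj ψ' hψ'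
  show ψ (insN ℓ c' (insN q c y)) = ψ (insN ℓ c' (insN (q + L) c y))
  obtain ⟨m, rfl⟩ : ∃ m, ℓ = m + 1 := ⟨ℓ - 1, by omega⟩
  rw [insN_comm q m (by omega), insN_comm (q + L) m (by omega)]
  exact hJ ψ hψ _ c

/-- (F5b) deleting the FIRST letter moves the location one step down. -/
theorem JN_down_first (P P' : ((ℕ → Bool) → V) → Prop) (q L : ℕ)
    (hsurj : ∀ ψ', P' ψ' → ∃ ψ c, P ψ ∧ resN 0 c ψ = ψ') (hJ : JN P (q + 1) L) : JN P' q L := by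
  intro ψ' hψ' y c
  obtain ⟨ψ, c', hψ, rfl⟩ := hsurj ψ' hψ'
  show ψ (insN 0 c' (insN q c y)) = ψ (insN 0 c' (insN (q + L) c y))
  rw [← insN_comm 0 q (by omega), ← insN_comm 0 (q + L) (by omega),
    show q + L + 1 = q + 1 + L by omega]
  exact hJ ψ hψ _ c

/-- (F6) propagation: from `JN (Ψ t) s L` down to level `s + L`, at every location. -/
theorem JN_all (Ψ : ℕ → ((ℕ → Bool) → V) → Prop) (t s L : ℕ) (ht : 2 * s + L ≤ t)
    (hfirst : ∀ ℓ, s + L ≤ ℓ → ℓ < t → ∀ ψ', Ψ ℓ ψ' → ∃ ψ c, Ψ (ℓ + 1) ψ ∧ resN 0 c ψ = ψ')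
    (hlast : ∀ ℓ, s + L ≤ ℓ → ℓ < t → ∀ ψ', Ψ ℓ ψ' → ∃ ψ c, Ψ (ℓ + 1) ψ ∧ resN ℓ c ψ = ψ')
    (hJ : JN (Ψ t) s L) :
    ∀ q, q + L < s + L → JN (Ψ (s + L)) q L := by
  -- claim by induction on j: at level t - j, locations q with s ≤ q + j, q ≤ s, q + L ≤ t - j - 1
  have claim : ∀ j, s + L + j ≤ t → ∀ q, s ≤ q + j → q ≤ s → q + L + 1 ≤ t - j → JN (Ψ (t - j)) q L := by
    intro j
    induction j with
    | zero =>
      intro _ q h1 h2 _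
      have : q = s := by omega
      subst this; simpa using hJ
    | succ j ih =>
      intro hj q h1 h2 h3
      have e : t - j = (t - (j + 1)) + 1 := by omega
      by_cases h : s ≤ q + j
      · -- last-letter deletion from level t - j
        apply JN_down_last (Ψ (t - j)) (Ψ (t - (j + 1))) (t - (j + 1)) q L (by omega)
        · intro ψ' hψ'
          have := hlast (t - (j + 1)) (by omega) (by omega) ψ' hψ'
          rw [← e] at this; exact this
        · exact ih (by omega) q h (by omega) (by omega)
      · -- first-letter deletion: q + j + 1 = s
        apply JN_down_first (Ψ (t - j)) (Ψ (t - (j + 1))) q L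
        · intro ψ' hψ'
          have := hfirst (t - (j + 1)) (by omega) (by omega) ψ' hψ'
          rw [← e] at this; exact this
        · exact ih (by omega) (q + 1) (by omega) (by omega) (by omega)
  intro q hq
  have := claim (t - (s + L)) (by omega) q (by omega) (by omega) (by omega)
  rwa [show t - (t - (s + L)) = s + L by omega] at this

/-! ## Bridge to K1: jump-invariance at every location ⟹ transposition invariance -/

/-- extend a `Fin n` word by `false`. -/
def ext (n : ℕ) (z : Fin n → Bool) : ℕ → Bool := fun i => if h : i < n then z ⟨i, h⟩ else false

/-- read the first `n` letters. -/
def rd (n : ℕ) (x : ℕ → Bool) : Fin n → Bool := fun i => x i.val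

/-- Extension by `false` commutes with right jumps below the level. -/
theorem ext_jr (n L q : ℕ) (hq : q + L < n) (z : Fin n → Bool) (i : ℕ) (hi : i < n) :
    ext n (jr L q z) i = jrN q L (ext n z) i := by
  have lhs : ext n (jr L q z) i = ext n z (jrIdx L q ⟨i, hi⟩).val := by
    simp only [ext, jr, dif_pos hi, dif_pos (jrIdx L q ⟨i, hi⟩).isLt, Fin.eta]
  rw [lhs, jrIdx_val L q hq]
  simp only [jrN, insN, delN]
  have exz : ∀ j : ℕ, n ≤ j → ext n z j = false := fun j hj => by simp [ext, show ¬ j < n by omega]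
  split_ifs <;> first | rfl | (congr 1; omega)

/-- A level-`n` word function: reads only positions `< n`. -/
def Reads (n : ℕ) (ψ : (ℕ → Bool) → V) : Prop := ∀ x x' : ℕ → Bool, (∀ i < n, x i = x' i) → ψ x = ψ x'

/-- Jump invariance at every location of a level-`n` word function gives transposition invariance below `n` (via K1). -/
theorem sym_of_JN (n L : ℕ) (hL : 1 ≤ L) (hn : 2 * L + 2 ≤ n) (ψ : (ℕ → Bool) → V) (hR : Reads n ψ)
    (hJ : ∀ q, q + L < n → ∀ (y : ℕ → Bool) (c : Bool), ψ (insN q c y) = ψ (insN (q + L) c y))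
    (a b : ℕ) (ha : a < n) (hb : b < n) (x : ℕ → Bool) : ψ (swN a b x) = ψ x := by
  -- the Fin-level function
  let ψF : (Fin n → Bool) → V := fun z => ψ (ext n z)
  have hJF : ∀ q : ℕ, q + L < n → ∀ z : Fin n → Bool, ψF (jr L q z) = ψF z := by
    intro q hq z
    show ψ (ext n (jr L q z)) = ψ (ext n z)
    have e1 : ψ (ext n (jr L q z)) = ψ (jrN q L (ext n z)) :=
      hR _ _ (fun i hi => ext_jr n L q hq z i hi)
    rw [e1]
    -- jrN = reinsertion of the deleted letter
    have e2 : ψ (ext n z) = ψ (insN q (ext n z q) (delN q (ext n z))) := by rw [insN_delN]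
    rw [e2]; exact (hJ q hq _ _).symm
  have K := swap_of_jump ψF L hL hn hJF ⟨a, ha⟩ ⟨b, hb⟩ (rd n x)
  -- translate back
  have r1 : ψ x = ψF (rd n x) := hR _ _ (fun i hi => by simp [ext, rd, hi])
  have r2 : ψ (swN a b x) = ψF (fun i => rd n x (Equiv.swap (⟨a, ha⟩ : Fin n) ⟨b, hb⟩ i)) := by
    apply hR; intro i hi
    simp only [ext, rd, swN, dif_pos hi]
    congr 1
    by_cases h1 : i = a
    · subst h1; simp [Equiv.swap_apply_left]
    · by_cases h2 : i = b
      · subst h2; simp [Equiv.swap_apply_right]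
      · rw [Equiv.swap_apply_of_ne_of_ne h1 h2, Equiv.swap_apply_of_ne_of_ne]
        · intro h; apply h1; simpa [Fin.ext_iff] using h
        · intro h; apply h2; simpa [Fin.ext_iff] using h
  rw [r1, r2]; exact K

/-! ## §6: symmetry descends along first-letter restrictions -/

/-- symmetric under all transpositions of positions `< n`. -/
def SymBelow (n : ℕ) (ψ : (ℕ → Bool) → V) : Prop := ∀ a b, a < n → b < n → ∀ x, ψ (swN a b x) = ψ x

/-- Shifting a transposition of positions by one. -/
theorem swap_succ (a b k : ℕ) : Equiv.swap (a + 1) (b + 1) (k + 1) = Equiv.swap a b k + 1 := by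
  rw [Equiv.swap_apply_def, Equiv.swap_apply_def]
  split_ifs <;> omega

/-- Inserting a first letter conjugates `swN a b` to `swN (a+1) (b+1)`. -/
theorem insN_zero_swN (a b : ℕ) (c : Bool) (y : ℕ → Bool) :
    insN 0 c (swN a b y) = swN (a + 1) (b + 1) (insN 0 c y) := by
  funext i
  cases i with
  | zero =>
    have h0 : Equiv.swap (a + 1) (b + 1) 0 = 0 := Equiv.swap_apply_of_ne_of_ne (by omega) (by omega)
    simp [insN, swN, h0]
  | succ k =>
    have h1 : Equiv.swap (a + 1) (b + 1) (k + 1) = Equiv.swap a b k + 1 := swap_succ a b k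
    simp [insN, swN, h1]

/-- Symmetry below `n+1` descends to the first-letter restriction (symmetry below `n`). -/
theorem symBelow_resN_zero (n : ℕ) (ψ : (ℕ → Bool) → V) (h : SymBelow (n + 1) ψ) (c : Bool) :
    SymBelow n (resN 0 c ψ) := by
  intro a b ha hb y
  show ψ (insN 0 c (swN a b y)) = ψ (insN 0 c y)
  rw [insN_zero_swN]; exact h (a+1) (b+1) (by omega) (by omega) _

/-- K2 MAIN.  A restriction system `Ψ` (levels `2 … t`): level-`ℓ` functions read positions `< ℓ`;
first-letter restrictions are surjective `Ψ (ℓ+1) → Ψ ℓ` for `2 ≤ ℓ < t`, last-letter restrictions are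
surjective for `s+L ≤ ℓ < t`; and ONE jump relation `J(s, L)` holds for all of `Ψ t`, with
`L + 2 ≤ s` and `2s + L ≤ t`.  Then every level-2 function is symmetric. -/
theorem level_two_symmetric (Ψ : ℕ → ((ℕ → Bool) → V) → Prop) (t s L : ℕ) (hL : 1 ≤ L)
    (hs : L + 2 ≤ s) (ht : 2 * s + L ≤ t)
    (hreads : ∀ ℓ ψ, Ψ ℓ ψ → Reads ℓ ψ)
    (hfirst : ∀ ℓ, 2 ≤ ℓ → ℓ < t → ∀ ψ', Ψ ℓ ψ' → ∃ ψ c, Ψ (ℓ + 1) ψ ∧ resN 0 c ψ = ψ')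
    (hlast : ∀ ℓ, s + L ≤ ℓ → ℓ < t → ∀ ψ', Ψ ℓ ψ' → ∃ ψ c, Ψ (ℓ + 1) ψ ∧ resN ℓ c ψ = ψ')
    (hJ : JN (Ψ t) s L) :
    ∀ g, Ψ 2 g → ∀ x, g (swN 0 1 x) = g x := by
  -- jumps everywhere on level s + L
  have hall := JN_all Ψ t s L ht (fun ℓ h1 h2 => hfirst ℓ (by omega) h2) hlast hJ
  -- symmetry on level s + L
  have hsym : ∀ ψ, Ψ (s + L) ψ → SymBelow (s + L) ψ := by
    intro ψ hψ a b ha hb x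
    exact sym_of_JN (s + L) L hL (by omega) ψ (hreads _ ψ hψ)
      (fun q hq y c => hall q hq ψ hψ y c) a b ha hb x
  -- descend to level 2
  have hdesc : ∀ j, s + L - j ≥ 2 → ∀ ψ, Ψ (s + L - j) ψ → SymBelow (s + L - j) ψ := by
    intro j
    induction j with
    | zero => intro _ ψ hψ; simpa using hsym ψ hψ
    | succ j ih =>
      intro hj ψ' hψ'
      obtain ⟨ψ, c, hψ, rfl⟩ := hfirst (s + L - (j + 1)) hj (by omega) ψ' hψ'
      have e : s + L - j = s + L - (j + 1) + 1 := by omega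
      have := ih (by omega) ψ (by rw [e]; exact hψ)
      rw [e] at this
      exact symBelow_resN_zero _ ψ this c
  intro g hg x
  have := hdesc (s + L - 2) (by omega) g (by rwa [show s + L - (s + L - 2) = 2 by omega])
  rw [show s + L - (s + L - 2) = 2 by omega] at this
  exact this 0 1 (by omega) (by omega) x

/-! ## §3: the pigeonhole producing one jump relation -/

section Pigeonhole
open Classical

/-- K2a (RAINBOW-PROOF §3).  If the top level `Φt` (≤ R functions) restricts, at every position `s < t`,
into a level `Φt1` of ≤ R functions, and `(R·R)^R < A`, `2A + 2 ≤ t`, then two positions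
`A+2 ≤ s < s' ≤ 2A+1` have identical restriction pairs for every `ψ ∈ Φt`: the jump `J(s, s'-s)`. -/
theorem exists_jump (R A t : ℕ) (hA : (R * R) ^ R < A) (ht : 2 * A + 2 ≤ t)
    (Φt Φt1 : Finset ((ℕ → Bool) → V)) (hct : Φt.card ≤ R) (hct1 : Φt1.card ≤ R)
    (hclosed : ∀ ψ ∈ Φt, ∀ s, s < t → ∀ c, resN s c ψ ∈ Φt1) :
    ∃ s L, A + 2 ≤ s ∧ 1 ≤ L ∧ s + L ≤ 2 * A + 1 ∧ JN (fun ψ => ψ ∈ Φt) s L := by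
  have hA2 : 2 ≤ A := by
    rcases Nat.eq_zero_or_pos R with h | h
    · subst h; simp at hA; omega
    · have := Nat.one_le_pow R (R * R) (Nat.mul_pos h h); omega
  by_cases hne : Φt = ∅
  · refine ⟨A + 2, 1, le_rfl, le_rfl, by omega, ?_⟩
    intro ψ hψ; simp [hne] at hψ
  -- Φt nonempty ⇒ Φt1 nonempty
  obtain ⟨ψ₀, hψ₀⟩ := Finset.nonempty_iff_ne_empty.2 hne
  have h1pos : 0 < Φt1.card := Finset.card_pos.2 ⟨_, hclosed ψ₀ hψ₀ 0 (by omega) false⟩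
  -- the colouring of the A window positions
  let col : Fin A → (↥Φt → ↥Φt1 × ↥Φt1) := fun i ψ =>
    (⟨resN (A + 2 + i.val) false ψ.1, hclosed ψ.1 ψ.2 _ (by omega) false⟩,
     ⟨resN (A + 2 + i.val) true ψ.1, hclosed ψ.1 ψ.2 _ (by omega) true⟩)
  have hcard : Fintype.card (↥Φt → ↥Φt1 × ↥Φt1) < Fintype.card (Fin A) := by
    rw [Fintype.card_fun, Fintype.card_prod, Fintype.card_coe, Fintype.card_coe, Fintype.card_fin]
    calc (Φt1.card * Φt1.card) ^ Φt.card ≤ (R * R) ^ Φt.card :=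
          Nat.pow_le_pow_left (Nat.mul_le_mul hct1 hct1) _
      _ ≤ (R * R) ^ R := Nat.pow_le_pow_right (Nat.mul_pos (by omega) (by omega)) hct
      _ < A := hA
  obtain ⟨i, j, hij, hcol⟩ := Fintype.exists_ne_map_eq_of_card_lt col hcard
  -- order the two positions
  have main : ∀ i j : Fin A, i.val < j.val → col i = col j →
      ∃ s L, A + 2 ≤ s ∧ 1 ≤ L ∧ s + L ≤ 2 * A + 1 ∧ JN (fun ψ => ψ ∈ Φt) s L := by
    intro i j hlt h
    refine ⟨A + 2 + i.val, j.val - i.val, by omega, by omega, by omega, ?_⟩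
    intro ψ hψ y c
    have h' := congrFun h ⟨ψ, hψ⟩
    simp only [col, Prod.mk.injEq, Subtype.mk.injEq] at h'
    have e : A + 2 + i.val + (j.val - i.val) = A + 2 + j.val := by omega
    rw [e]
    cases c
    · exact congrFun h'.1 y
    · exact congrFun h'.2 y
  rcases Nat.lt_or_gt_of_ne (fun h => hij (Fin.ext h)) with hlt | hgt
  · exact main i j hlt hcol
  · exact main j i hgt hcol.symm

end Pigeonhole

/-- K2 (RAINBOW-PROOF §3–§6, kernel).  A THIN HOMOGENEOUS RESTRICTION SYSTEM has symmetric level 2.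
Levels `Ψ ℓ` (2 ≤ ℓ ≤ t) of word functions reading positions `< ℓ`; first- and last-letter restrictions
`Ψ (ℓ+1) → Ψ ℓ` surjective (2 ≤ ℓ < t); every restriction of a top-level function lies in level `t-1`;
levels `t` and `t-1` have at most `R` elements; `(R·R)^R < A` and `5A + 1 ≤ t`. -/
theorem level_two_symmetric_of_thin (Ψ : ℕ → ((ℕ → Bool) → V) → Prop) (R A t : ℕ)
    (hA : (R * R) ^ R < A) (ht : 5 * A + 1 ≤ t)
    (Φt Φt1 : Finset ((ℕ → Bool) → V)) (hΦt : ∀ ψ, Ψ t ψ ↔ ψ ∈ Φt)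
    (hΦt1 : ∀ ψ, Ψ (t - 1) ψ ↔ ψ ∈ Φt1) (hct : Φt.card ≤ R) (hct1 : Φt1.card ≤ R)
    (hclosed : ∀ ψ, Ψ t ψ → ∀ s, s < t → ∀ c, Ψ (t - 1) (resN s c ψ))
    (hreads : ∀ ℓ ψ, Ψ ℓ ψ → Reads ℓ ψ)
    (hfirst : ∀ ℓ, 2 ≤ ℓ → ℓ < t → ∀ ψ', Ψ ℓ ψ' → ∃ ψ c, Ψ (ℓ + 1) ψ ∧ resN 0 c ψ = ψ')
    (hlast : ∀ ℓ, 2 ≤ ℓ → ℓ < t → ∀ ψ', Ψ ℓ ψ' → ∃ ψ c, Ψ (ℓ + 1) ψ ∧ resN ℓ c ψ = ψ') :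
    ∀ g, Ψ 2 g → ∀ x, g (swN 0 1 x) = g x := by
  obtain ⟨s, L, hs, hL, hsL, hJ⟩ := exists_jump R A t hA (by omega) Φt Φt1 hct hct1
    (fun ψ hψ s hs c => (hΦt1 _).1 (hclosed ψ ((hΦt ψ).2 hψ) s hs c))
  have hJ' : JN (Ψ t) s L := fun ψ hψ y c => hJ ψ ((hΦt ψ).1 hψ) y c
  exact level_two_symmetric Ψ t s L hL (by omega) (by omega) hreads hfirst
    (fun ℓ h1 h2 => hlast ℓ (by omega) h2) hJ'

/-! ## Axiom guards (K2) -/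

/--
info: 'Summit.QuantumAdvantage.QuantumAdvantage.Theorems.TransferDial.HomSys.level_two_symmetric' depends on axioms: [propext,
 Classical.choice,
 Quot.sound]
-/
#guard_msgs in #print axioms level_two_symmetric

/--
info: 'Summit.QuantumAdvantage.QuantumAdvantage.Theorems.TransferDial.HomSys.level_two_symmetric_of_thin' depends on axioms: [propext,
 Classical.choice,
 Quot.sound]
-/
#guard_msgs in #print axioms level_two_symmetric_of_thin

end Summit.QuantumAdvantage.QuantumAdvantage.Theorems.TransferDial.HomSys
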